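import Summits.QuantumAdvantage.QuantumAdvantage.Theses.WhiteBoxWalk
import Summits.QuantumAdvantage.QuantumAdvantage.Theorems.WbwVerifiableLineNoSpeedup.Negative.LoadBearing
import Summits.QuantumAdvantage.QuantumAdvantage.Theorems.WbwVerifiableLineNoSpeedup.Negative.Tightness
import Summits.QuantumAdvantage.QuantumAdvantage.Theorems.WbwVerifiableLineNoSpeedup.Negative.QueryReindex
import Literature.Computability.QuantumComplexity.SinkOfVerifiableLine
import Literature.Computability.QuantumComplexity.ExactQuantumQuery

/-!
# Line `mergefree-line-recording` — skeleton for crux `WhiteBoxWalk.WbwVerifiableLineNoSpeedup`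
(stmt-QuantumAdvantage-2239), crux-plan seat, round 1, 2026-08-16 (gen 1); revised by the gen-2 crux-plan seat
the same day: the four registered stubs and the composition are UNCHANGED (same names, same signatures);
the `Q ≥ 1` glue is now imported from the landed `Negative/Tightness.lean` instead of being reproduced, and all
three landed `Negative/` files of the crux are imported so that every stub is checked against them in one
elaboration (no stub is an instance of a landed negative lemma; see the last paragraph).

Crux (by `Negative.crux_iff`, `Iff.rfl`):
`∃ c > 0, ∀ m T, 2 ≤ m → 1 ≤ T → T + 1 ≤ 2^(m-1) → c · min (T+1) √(2^m) / m ≤ svlQ m T`,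
`svlQ m T = Q_{1/3}(svlPromise m T, svlSinkBit m T)` in the tree's BIT-query model `QQueryAlg`.

THE LINE (idea card `Ideas/mergefree-line-recording.md`; triage TRIAGE-r1-{1,2,3}: pass).
Average over the MERGE-FREE hard distribution J′ (`IsMergeFree`: an input with a verifiable line whose
every other row — off-line rows AND the sink's row — points OFF the line; uniform over `mfInputs m T`).
The line's thesis is the average-case bound

  X⁺ = `MergeFreeAverageBound` : J′-average correctness of ANY `q`-query algorithm is
       `≤ 1/2 + C (q+1)/√(2^m)` whenever `q + 1 ≤ T`,

from which the crux follows by Yao averaging (`yaoOnMergeFree_holds`, PROVED here), `Q ≥ 1`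
(`Negative.one_le_svlQ_of_hyps`, landed, imported) and arithmetic (certified glue `crux_of_avgBound`).  X⁺ itself is the output of the RECORDING ENGINE
`stub_recordingEngine` (K1 of the card, the hardest stub: a quantum lazy-sampling / recording
representation of the joint (S,V) bit-oracle under the NON-product distribution J′, Rosmanis-2021-type
graded subspaces), which lifts three CLASSICAL counting facts about J′-posteriors given a small ROW-LEVEL
transcript (`Transcript` = revealed successor rows + tested verifier cells — exactly what a database records;
a Zhandry/CFHL database holds FULL rows even for single-bit phase queries, and at bit level the dichotomy
below would be false: `m-1` known bits of row `x_i` leave two candidates for `x_{i+1}`):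

* `stub_chainBound`      (P1, sequentiality is COMBINATORIAL): if every recorded positive test is supported
  by the recorded 0-chain, every level beyond that chain (in particular every level `> #rows`) is UNFORCED —
  re-route the line through fresh names; no probability estimate at all ("q links pin ≤ q levels").
* `stub_posteriorDichotomy` (K2a, the merge-free TEST bound): given a transcript of size `s`, `4s² ≤ 2^m`,
  the posterior that name `y` sits at level `i` is either `1` (forced) or `≤ 64/2^m` — because J′ cannot
  MERGE (off-line walks never enter the line), the only posterior boost is the `e^{s²/2M} ≤ e^{1/4}`
  injective-chain likelihood; this is the `2^{-m/2}`-per-test-query disturbance in classical currency.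
* `stub_parityBalance`   (K2b, read-out): if level `T` is unforced, the sink PARITY is unbiased up to
  `400 (s+1)/2^m` (relabelling symmetry `Sym(names ∖ (mentioned ∪ {0}))` of J′).

`crux_of_parts` composes the four stub STATEMENTS (named Props) into the crux body, sorry-free;
`WbwVerifiableLineNoSpeedup_of : WbwVerifiableLineNoSpeedup` instantiates it with the registered stubs
(crux BY NAME via `Negative.crux_iff`; `sorry` only inside `stub_*`).

Disproof.lean (cdisprove gen 1, cycle 1, verdict RESISTS; sorry-free) honoured — and the landed negative
lemmas are IMPORTED (`Negative.LoadBearing`, `Negative.Tightness`, `Negative.QueryReindex`; this file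
elaborates against all three): `wbwVerifiableLineNoSpeedup_false_without_Tpos` (LoadBearing) — `1 ≤ T` is
USED, in `crux_of_avgBound` (walk branch `(T+1)/2 ≤ T`, and `Q ≥ 1`) and in `yaoOnMergeFree_holds` (J′ ≠ ∅);
`wbwVerifiableLineNoSpeedup_false_without_Tbound` (LoadBearing) — `T + 1 ≤ 2^(m-1)` is a hypothesis of EVERY
classical stub (it is `|OFF| ≥ 2^(m-1)`, the denominator of the dichotomy and the room for re-routing) and of
X⁺, and it feeds `one_le_svlQ_of_hyps`; so no stub drops a load-bearing hypothesis and none is an instance of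
the two `_false_without_` theorems.  Tightness (`Negative.Tightness`): `svlQ_le_mul` (`Q ≤ m·T`),
`svlQ_one_eq_one`, `admissible_const_le_one` (`c ≤ 1`: ours is `c = min (1/2) (1/(12 C)) ≤ 1/2`), the refuted
strengthening `not_groverBranchOnly` — X⁺ keeps the walk branch as the hypothesis `q + 1 ≤ T` and claims only
the Grover slope `(q+1)/√(2^m)` below it, i.e. exactly the two-branch shape, nothing stronger; `pointwise_bound`
— every stub is a finite statement, the engine's constant `C` is existential, as it must be.  `Negative.
QueryReindex` (re-indexing / bit-copy reductions, the tool behind `PaddingMonotone`) is not needed by this line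
(X⁺ is uniform in `T`, no padding) and is imported only for the clash check.  Disproof §6.2 (attack ledger) is
the informal truth certificate for X⁺ on J′; §6.3 (truncation hybrid, `(T+1)³ ≤ 2^m`) is the warm-up regime of
`stub_recordingEngine`; §7 (`crux_of_smallT_of_padding`, relational adversary) is the COMPETING line
(`Lines/cycle-surgery-adversary.lean`), independent of this one.
-/

set_option linter.dupNamespace false
set_option linter.unusedVariables false

noncomputable section

namespace Summit.QuantumAdvantage.QuantumAdvantage.Cruxes.WbwVerifiableLineNoSpeedup.MergefreeLineRecording

open Literature.Computability.Cryptography Literature.Computability.QuantumComplexity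
open Summit.QuantumAdvantage.QuantumAdvantage.Theses.WhiteBoxWalk (WbwVerifiableLineNoSpeedup)
open Summit.QuantumAdvantage.QuantumAdvantage.Theorems.WbwVerifiableLineNoSpeedup.Negative
  (svlQ crux_iff succ_succ_le_two_pow_of_hyps one_le_svlQ_of_hyps)

variable {m T : ℕ}

/-! ### Vocabulary 1: the merge-free distribution J′ and averages over it -/

/-- `t` is a MERGE-FREE instance (hard distribution J′ of the card): it has a verifiable line `xs`, and
every row not on the open line `x₀ … x_{T-1}` — i.e. every off-line name and the sink `x_T` — has its
successor OFF the whole line.  Off-line walks never enter the line; nothing points to `0`. -/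
def IsMergeFree (t : SVLInput m T) : Prop :=
  ∃ xs : Fin (T + 1) → Fin (2 ^ m), IsSvlLine t xs ∧
    ∀ y : Fin (2 ^ m), (∀ i : Fin T, y ≠ xs i.castSucc) → ∀ i : Fin (T + 1), svlSucc t y ≠ xs i

open Classical in
/-- The support of J′ as a finite set of inputs (J′ = the uniform distribution on it). -/
def mfInputs (m T : ℕ) : Finset (SVLInput m T) := Finset.univ.filter fun t => IsMergeFree t

theorem mem_mfInputs {t : SVLInput m T} : t ∈ mfInputs m T ↔ IsMergeFree t := by
  simp [mfInputs]

/-- J′ is supported on the promise set (Yao averaging is legitimate). -/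
theorem mem_svlPromise_of_isMergeFree {t : SVLInput m T} (h : IsMergeFree t) : t ∈ svlPromise m T := by
  obtain ⟨xs, hxs, -⟩ := h
  exact ⟨xs, hxs⟩

/-- J′-average of a real function of the input. -/
def mfAvg (m T : ℕ) (F : SVLInput m T → ℝ) : ℝ :=
  (∑ t ∈ mfInputs m T, F t) / ((mfInputs m T).card : ℝ)

/-- Probability that `A` answers the sink bit of `t` correctly. -/
def correctProb (m T : ℕ) (A : QQueryAlg (2 ^ m * m + 2 ^ m * (T + 1))) (t : SVLInput m T) : ℝ :=
  if svlSinkBit m T t = true then A.acceptProb t else 1 - A.acceptProb t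

/-! ### Vocabulary 2: row-level transcripts (= database contents) and J′-posteriors -/

/-- A row-level partial transcript / database: some successor ROWS revealed in full (`rows y = some v`
means `S(y) = v` is known) and some verifier CELLS tested (`tests y i = some b` means `V(y,i) = b` is known). -/
structure Transcript (m T : ℕ) where
  rows : Fin (2 ^ m) → Option (Fin (2 ^ m))
  tests : Fin (2 ^ m) → Fin (T + 1) → Option Bool

namespace Transcript

/-- number of revealed rows -/
def rowCount (τ : Transcript m T) : ℕ :=
  (Finset.univ.filter fun y : Fin (2 ^ m) => (τ.rows y).isSome).card

/-- number of tested cells -/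
def testCount (τ : Transcript m T) : ℕ :=
  (Finset.univ.filter fun p : Fin (2 ^ m) × Fin (T + 1) => (τ.tests p.1 p.2).isSome).card

/-- size of the transcript (what `q` name-level queries can produce: `size ≤ q`) -/
def size (τ : Transcript m T) : ℕ := τ.rowCount + τ.testCount

/-- the input `t` agrees with everything the transcript records -/
def Consistent (τ : Transcript m T) (t : SVLInput m T) : Prop :=
  (∀ y v, τ.rows y = some v → svlSucc t y = v) ∧ ∀ y i b, τ.tests y i = some b → svlVerify t y i = b

/-- follow the REVEALED rows from the source `0` for `k` steps (`none` as soon as a row is unrevealed):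
the recorded 0-anchored chain. -/
def dbChain (τ : Transcript m T) : ℕ → Option (Fin (2 ^ m))
  | 0 => some ⟨0, Nat.two_pow_pos m⟩
  | k + 1 => (dbChain τ k).bind τ.rows

/-- every recorded POSITIVE test sits on the recorded 0-chain ("no lucky test has happened": the
invariant of the cheap component in the recording argument; free positives are allowed). -/
def Supported (τ : Transcript m T) : Prop :=
  ∀ y i, τ.tests y i = some true → τ.dbChain i.val = some y

end Transcript

open Classical in
/-- the J′-instances consistent with `τ` -/
def consSet (τ : Transcript m T) : Finset (SVLInput m T) :=
  (mfInputs m T).filter fun t => τ.Consistent t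

/-- … among them, those whose level-`i` vertex is `y` (on the promise `V(y,i) = [y = x_i]`) -/
def consAt (τ : Transcript m T) (y : Fin (2 ^ m)) (i : Fin (T + 1)) : Finset (SVLInput m T) :=
  (consSet τ).filter fun t => svlVerify t y i = true

/-- `τ` FORCES name `y` at level `i`: every consistent J′-instance has `x_i = y` (semantic closure — it
contains the forward chains from `0` and from pinned marks AND the backward closure along recorded rows
into pinned names, cf. triage r1-2/r1-3 sharpenings; vacuous when nothing is consistent). -/
def Forces (τ : Transcript m T) (y : Fin (2 ^ m)) (i : Fin (T + 1)) : Prop :=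
  ∀ t ∈ consSet τ, svlVerify t y i = true

/-- level `i` is UNFORCED by `τ`: every name is refuted by some consistent J′-instance. -/
def Unforced (τ : Transcript m T) (i : Fin (T + 1)) : Prop :=
  ∀ y : Fin (2 ^ m), ∃ t ∈ consSet τ, svlVerify t y i = false

/-! ### Certified glue on the transcript vocabulary (provable-now lemmas in the engine's cone) -/

/-- Along a consistent instance with verifiable line `xs`, the recorded 0-chain FOLLOWS THE LINE:
`τ.dbChain k = some y` with `k ≤ T` forces `y = xs k`. -/
theorem dbChain_eq_line {τ : Transcript m T} {t : SVLInput m T} {xs : Fin (T + 1) → Fin (2 ^ m)}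
    (hxs : IsSvlLine t xs) (hcons : τ.Consistent t) :
    ∀ (k : ℕ) (hk : k < T + 1) (y : Fin (2 ^ m)), τ.dbChain k = some y → y = xs ⟨k, hk⟩
  | 0, hk, y, h => by
      simp only [Transcript.dbChain, Option.some.injEq] at h
      have h0 : (⟨0, hk⟩ : Fin (T + 1)) = 0 := Fin.ext rfl
      rw [← h, h0]
      exact Fin.ext hxs.source.symm
  | k + 1, hk, y, h => by
      simp only [Transcript.dbChain] at h
      cases hdb : τ.dbChain k with
      | none => rw [hdb] at h; simp at h
      | some y' =>
        rw [hdb] at h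
        change τ.rows y' = some y at h
        have ih := dbChain_eq_line hxs hcons k (Nat.lt_of_succ_lt hk) y' hdb
        have hS : svlSucc t y' = y := hcons.1 y' y h
        have hline := hxs.svlSucc_eq ⟨k, Nat.lt_of_succ_lt_succ hk⟩
        have hcast : (⟨k, Nat.lt_of_succ_lt_succ hk⟩ : Fin T).castSucc = ⟨k, Nat.lt_of_succ_lt hk⟩ := Fin.ext rfl
        have hsucc : (⟨k, Nat.lt_of_succ_lt_succ hk⟩ : Fin T).succ = ⟨k + 1, hk⟩ := Fin.ext rfl
        rw [hcast, ← ih, hS, hsucc] at hline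
        exact hline

/-- **The recorded 0-chain is semantically forced**: if `τ.dbChain i = some y` then every consistent
J′-instance has `x_i = y` (`Forces τ y i`).  This is the "free positive test" case of the engine: a test on the
recorded chain has a certain outcome and keeps `Supported`. -/
theorem forces_of_dbChain {τ : Transcript m T} {i : Fin (T + 1)} {y : Fin (2 ^ m)}
    (h : τ.dbChain i.val = some y) : Forces τ y i := by
  intro t ht
  simp only [consSet, Finset.mem_filter, mem_mfInputs] at ht
  obtain ⟨⟨xs, hxs, -⟩, hcons⟩ := ht
  have hy := dbChain_eq_line hxs hcons i.val i.isLt y h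
  exact hxs.svlVerify_eq_true_iff.2 (hy.trans (congrArg xs (Fin.ext rfl)))

/-! ### The stub statements (and the two proved ones) as named Props -/

/-- P1 (sequentiality, combinatorial).  For a small transcript all of whose positive tests are supported by
the recorded 0-chain: every level not reached by that chain — and every level beyond the number of revealed
rows (pigeonhole: the consistent 0-chain is injective) — is unforced. -/
def ChainBound : Prop :=
  ∀ (m T : ℕ) (τ : Transcript m T) (i : Fin (T + 1)),
    T + 1 ≤ 2 ^ (m - 1) → 4 * τ.size ^ 2 ≤ 2 ^ m → τ.Supported → (consSet τ).Nonempty →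
    (τ.dbChain i.val = none ∨ τ.rowCount < i.val) → Unforced τ i

/-- K2a (merge-free test bound, classical currency of the `2^{-m/2}` test disturbance).  Given a small
transcript, the J′-posterior of "`y` is the level-`i` vertex" is either `1` (forced) or at most `64/2^m`. -/
def PosteriorDichotomy : Prop :=
  ∀ (m T : ℕ) (τ : Transcript m T) (y : Fin (2 ^ m)) (i : Fin (T + 1)),
    T + 1 ≤ 2 ^ (m - 1) → 4 * τ.size ^ 2 ≤ 2 ^ m →
    Forces τ y i ∨ 2 ^ m * (consAt τ y i).card ≤ 64 * (consSet τ).card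

/-- K2b (read-out).  Given a small transcript that leaves level `T` unforced, the sink parity is unbiased
up to `400 (size+1) / 2^m` over the consistent J′-instances. -/
def ParityBalance : Prop :=
  ∀ (m T : ℕ) (τ : Transcript m T),
    T + 1 ≤ 2 ^ (m - 1) → 4 * τ.size ^ 2 ≤ 2 ^ m → Unforced τ (Fin.last T) →
    (2 : ℤ) ^ m * |(((consSet τ).filter fun t => svlSinkBit m T t = true).card : ℤ)
        - (((consSet τ).filter fun t => svlSinkBit m T t = false).card : ℤ)|
      ≤ 400 * ((τ.size : ℤ) + 1) * ((consSet τ).card : ℤ)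

/-- X⁺, THE THESIS OF THE LINE (output of the recording engine K1).  On J′-average no algorithm with
`q + 1 ≤ T` bit-queries answers the sink parity with advantage more than `C (q+1)/√(2^m)`. -/
def MergeFreeAverageBound : Prop :=
  ∃ C : ℝ, 0 < C ∧ ∀ (m T : ℕ) (A : QQueryAlg (2 ^ m * m + 2 ^ m * (T + 1))),
    1 ≤ T → T + 1 ≤ 2 ^ (m - 1) → A.queries + 1 ≤ T →
      mfAvg m T (correctProb m T A) ≤ 1 / 2 + C * ((A.queries : ℝ) + 1) / Real.sqrt (2 ^ m)

/-- K3 (Yao averaging + model plumbing).  An algorithm with error `1/3` on the promise is correct with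
probability `≥ 2/3` on every J′-instance (`J′ ⊆ svlPromise`, `J′ ≠ ∅` under the crux's hypotheses), hence
on J′-average. -/
def YaoOnMergeFree : Prop :=
  ∀ (m T : ℕ) (A : QQueryAlg (2 ^ m * m + 2 ^ m * (T + 1))),
    1 ≤ T → T + 1 ≤ 2 ^ (m - 1) → A.ComputesWithError (1 / 3) (svlPromise m T) (svlSinkBit m T) →
      2 / 3 ≤ mfAvg m T (correctProb m T A)

/-! ### Registered stubs -/

/-- STUB 1 (P1; size M; TRUE by re-routing).  `ChainBound`: for `τ` with `4·size² ≤ 2^m`, all positive tests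
supported by the recorded 0-chain, and some consistent J′-instance: any level `i` NOT reached by the recorded
0-chain, or with `i > #revealed rows`, is unforced.  Proof plan: take a consistent instance, let `j₀` be the
first level whose row is unrevealed (`j₀ ≤ #rows`, and `j₀ <` any level past the chain), keep the prefix
`x₀ … x_{j₀}` and re-route the rest of the line through FRESH names (unmentioned by `τ`, off the prefix:
`≥ 2^m − 2·rows − tests − j₀ − 1 ≥ T − j₀ + 1` of them since `T + 1 ≤ 2^(m-1)` and `2·size ≤ √(2^m)`),
choosing the new level-`i` vertex `≠ y`; old suffix names become off-line and their revealed rows still point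
off the new line (revealed values are mentioned, fresh names are not), negative tests stay negative, supported
positives live on the prefix.  This is the card's `dbChain_eq_none` in the SEMANTIC form the read-out needs. -/
theorem stub_chainBound (m T : ℕ) (τ : Transcript m T) (i : Fin (T + 1))
    (hTm : T + 1 ≤ 2 ^ (m - 1)) (hsmall : 4 * τ.size ^ 2 ≤ 2 ^ m) (hsup : τ.Supported)
    (hne : (consSet τ).Nonempty) (hi : τ.dbChain i.val = none ∨ τ.rowCount < i.val) :
    Unforced τ i := by
  sorry

/-- STUB 2 (K2a; size M–L; the merge-free test bound).  `PosteriorDichotomy`: for `4·size² ≤ 2^m`,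
`T + 1 ≤ 2^(m-1)`: `Forces τ y i ∨ 2^m · #consAt ≤ 64 · #consSet`.  Proof plan: (1) `y` unmentioned in `τ`:
the relabelling group `Sym(names ∖ (mentioned ∪ {0}))` acts on `consSet τ` and is transitive on unmentioned
names, so the posterior is `≤ 1/(2^m − 1 − 2·rows − tests) ≤ 2/2^m`; (2) `y` mentioned: case analysis —
tested positive at `(y,i)` ⇒ forced; tested negative ⇒ `0`; `y` on a revealed FLOATING chain of length
`L ≤ size` ⇒ likelihood ratio on-line : off-line at a given offset is `∏_{k<L} M/(M−k) · 1/(M−L)` with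
`M = |OFF| ≥ 2^(m-1)`, i.e. `≤ e^{L²/2M}/(M−L) ≤ e^{1/4}·4/2^m`; two revealed rows into one name ⇒ that name is
off-line (MERGE-FREENESS: nothing off-line points into the line, the sink points off it) ⇒ `0` or forced by
backward closure; a revealed row `y → v` with `(v, i+1)` forced ⇒ `(y, i)` forced.  Why it is not `o(1)`-false:
the only super-constant likelihood boost in J′ is the injective-chain factor `e^{L²/2M}`, tamed by `4 size² ≤ 2^m`
(for `L ≈ 2^{0.6 m}` the dichotomy WOULD fail: posterior `≈ 1/(T−L)`).  Under uniformly random FUNCTION junk the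
analogous statement is false at `(L+1)/2^m` (merging; triage j009684/j009780) — the reason the line lives on J′. -/
theorem stub_posteriorDichotomy (m T : ℕ) (τ : Transcript m T) (y : Fin (2 ^ m)) (i : Fin (T + 1))
    (hTm : T + 1 ≤ 2 ^ (m - 1)) (hsmall : 4 * τ.size ^ 2 ≤ 2 ^ m) :
    Forces τ y i ∨ 2 ^ m * (consAt τ y i).card ≤ 64 * (consSet τ).card := by
  sorry

/-- STUB 3 (K2b; size M; read-out balance).  `ParityBalance`: if level `T` is unforced then
`2^m · |#odd-sink − #even-sink| ≤ 400 (size+1) · #consSet` over the consistent J′-instances.  Proof plan: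
unmentioned names carry equal posterior (relabelling symmetry) and among the unmentioned non-excluded names
the odd/even counts differ by `≤ 2·rows + tests + 1`; mentioned names (`≤ 2·size` of them) each carry posterior
`≤ 64/2^m` unless forced (excluded by `Unforced`); total bias `≤ (128 size + 4 size + 2)/2^m`. -/
theorem stub_parityBalance (m T : ℕ) (τ : Transcript m T)
    (hTm : T + 1 ≤ 2 ^ (m - 1)) (hsmall : 4 * τ.size ^ 2 ≤ 2 ^ m) (hunf : Unforced τ (Fin.last T)) :
    (2 : ℤ) ^ m * |(((consSet τ).filter fun t => svlSinkBit m T t = true).card : ℤ)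
        - (((consSet τ).filter fun t => svlSinkBit m T t = false).card : ℤ)|
      ≤ 400 * ((τ.size : ℤ) + 1) * ((consSet τ).card : ℤ) := by
  sorry

/-- STUB 4 — HARDEST (K1; size XL; the RECORDING ENGINE).  The quantum lazy-sampling transfer for the joint
(S,V) bit-oracle under J′: from the three classical inputs to X⁺ = `MergeFreeAverageBound`.
Intended proof (card K1 (a)(b)(c), triage sharpenings applied): purify the J′-average run of `A`
(`Ψ_t = |mfInputs|^{-1/2} Σ_I |I⟩ ⊗ stateAt A I t`), and exhibit a RECORDING representation — an isometry of
the instance register onto a database register spanned by row-level transcripts (Rosmanis 2021 graded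
"values learnt" subspaces for the injective part, Zhandry/CFHL for the product junk part `OFF → OFF`) — with:
(a) one S-bit-query changes the database by ≤ 1 revealed row and keeps `Supported`; (b) one V-bit-query at a
cell `(y,i)` maps the `Supported` sector to the `¬Supported` ("lucky") sector with operator norm
`≤ √(64/2^m) = 8·2^{-m/2}` — by `hK2a` a test is either forced (then, by `hP1` + supportedness, ON the recorded
chain: outcome certain, stays `Supported`) or has positive-outcome weight `≤ 64/2^m`; (c) read-out: in the
`Supported` component with `≤ q < T` revealed rows, `hP1` (second disjunct, `i = T`) makes level `T` unforced and
`hK2b` bounds the correctness by `1/2 + 200(q+1)/2^m`; the lucky component has norm `≤ 8q·2^{-m/2}` and costs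
`≤ 16 q /√(2^m)` in probability (`abs_acceptProb_sub_le`-type estimate).  Total: `C = 216` suffices.
Bit queries: the database records the FULL row on first touch (lazy sampling is w.r.t. the database, not the
algorithm's view), so the classical inputs are consumed at row level; `4q² ≤ 2^m` may be assumed since for
`q + 1 > √(2^m)/2` the bound is vacuous once `C ≥ 1`.  Why it might fail: no quadratically tight recording
formalism for a NON-product table with test queries is in print (MMW25 Thm 1.1 cubic; Rosmanis 2021 inversion
only; CFHL21 functions only) — this stub IS that construction for J′.  Warm-up available: the truncation
hybrid of Disproof §6.3 proves the conclusion for `(T+1)^3 ≤ 2^m` with tree tools (QueryHybridBound). -/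
theorem stub_recordingEngine (hP1 : ChainBound) (hK2a : PosteriorDichotomy) (hK2b : ParityBalance) :
    ∃ C : ℝ, 0 < C ∧ ∀ (m T : ℕ) (A : QQueryAlg (2 ^ m * m + 2 ^ m * (T + 1))),
      1 ≤ T → T + 1 ≤ 2 ^ (m - 1) → A.queries + 1 ≤ T →
        mfAvg m T (correctProb m T A) ≤ 1 / 2 + C * ((A.queries : ℝ) + 1) / Real.sqrt (2 ^ m) := by
  sorry

/-! ### Certified glue 0: J′ is nonempty and Yao averaging (K3 of the card, proved here) -/

/-- Successor table of the explicit merge-free instance: `x ↦ x + 1` below `T`, every other row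
(off-line names and the sink `T`) `↦ T + 1`, an off-line name. -/
def strS (m T : ℕ) (h : T + 2 ≤ 2 ^ m) (x : Fin (2 ^ m)) : Fin (2 ^ m) :=
  if hx : x.val < T then ⟨x.val + 1, by omega⟩ else ⟨T + 1, by omega⟩

theorem strS_val (h : T + 2 ≤ 2 ^ m) (x : Fin (2 ^ m)) :
    (strS m T h x).val = if x.val < T then x.val + 1 else T + 1 := by
  unfold strS
  split_ifs <;> rfl

/-- The explicit merge-free instance on the straight line `0, 1, …, T`. -/
def strInput (m T : ℕ) (h : T + 2 ≤ 2 ^ m) : SVLInput m T :=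
  svlInput m T (strS m T h) fun x i => decide (x = svlStraightLine ((Nat.le_succ _).trans h) i)

theorem strInput_isMergeFree (h : T + 2 ≤ 2 ^ m) : IsMergeFree (strInput m T h) := by
  have hs : T + 1 ≤ 2 ^ m := (Nat.le_succ _).trans h
  refine ⟨svlStraightLine hs, ?_, ?_⟩
  · rw [strInput, isSvlLine_iff]
    refine ⟨fun i j hij => Fin.ext (Fin.mk.inj_iff.1 hij), rfl, fun i => ?_, fun x i => ?_⟩
    · rw [svlSucc_svlInput]
      apply Fin.ext
      rw [strS_val]
      simp [svlStraightLine]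
    · rw [svlVerify_svlInput]
  · intro y hy i
    rw [strInput, svlSucc_svlInput]
    have hyT : ¬ y.val < T := fun hlt => hy ⟨y.val, hlt⟩ (Fin.ext (by simp [svlStraightLine]))
    intro heq
    have hv := congrArg Fin.val heq
    rw [strS_val, if_neg hyT] at hv
    have hi := i.isLt
    simp only [svlStraightLine] at hv
    omega

/-- **J′ is nonempty** as soon as `T + 2 ≤ 2^m` (implied by the crux's hypotheses,
`Negative.succ_succ_le_two_pow_of_hyps`): the definitions above are not vacuous. -/
theorem mfInputs_nonempty (h : T + 2 ≤ 2 ^ m) : (mfInputs m T).Nonempty :=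
  ⟨strInput m T h, mem_mfInputs.2 (strInput_isMergeFree h)⟩

/-- **K3 of the card, PROVED: Yao averaging on J′.**  A `1/3`-error algorithm on the promise is correct with
probability `≥ 2/3` at every J′-instance (`J′ ⊆ svlPromise`), hence on J′-average (`J′ ≠ ∅`). -/
theorem yaoOnMergeFree_holds : YaoOnMergeFree := by
  intro m T A hT hTm hA
  have h2 : T + 2 ≤ 2 ^ m := succ_succ_le_two_pow_of_hyps hT hTm
  have hne : (mfInputs m T).Nonempty := mfInputs_nonempty h2
  have hcard : (0 : ℝ) < ((mfInputs m T).card : ℝ) := by exact_mod_cast hne.card_pos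
  have hpt : ∀ t ∈ mfInputs m T, (2 : ℝ) / 3 ≤ correctProb m T A t := by
    intro t ht
    have hmem : t ∈ svlPromise m T := mem_svlPromise_of_isMergeFree (mem_mfInputs.1 ht)
    have hct := hA t hmem
    unfold correctProb
    split_ifs with hbit
    · have h1 := hct.1 hbit
      linarith
    · have hf : svlSinkBit m T t = false := by simpa using hbit
      have h1 := hct.2 hf
      linarith
  unfold mfAvg
  rw [le_div_iff₀ hcard]
  calc 2 / 3 * ((mfInputs m T).card : ℝ) = ∑ t ∈ mfInputs m T, (2 : ℝ) / 3 := by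
        rw [Finset.sum_const, nsmul_eq_mul]
        ring
    _ ≤ ∑ t ∈ mfInputs m T, correctProb m T A t := Finset.sum_le_sum hpt

/-! ### Certified glue I: `Q ≥ 1` under the crux's hypotheses — now IMPORTED
(`Negative.one_le_svlQ_of_hyps`, landed in `Theorems/WbwVerifiableLineNoSpeedup/Negative/Tightness.lean`,
refuter-cdisprove cycle 1; the gen-1 skeleton carried a verbatim copy because the file had not landed yet).
It is needed because Yao averaging alone cannot exclude `Q = 0` at `m = 2`, where the J′-average parity bias
is exactly `1/6`. -/

/-! ### Certified glue II: X⁺ + Yao ⇒ the crux (arithmetic of the two branches) -/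

/-- **X⁺ and Yao averaging imply the crux**, with `c = min (1/2) (1/(12 C))`: for the optimal algorithm
(`exists_queries_eq_quantumQueryComplexityOn`, `q = svlQ m T ≥ 1`) either `q ≥ T ≥ (T+1)/2` (walk branch) or
`2/3 ≤ 1/2 + C(q+1)/√(2^m)`, i.e. `q ≥ (q+1)/2 ≥ √(2^m)/(12C)` (Grover branch); dividing by `m ≥ 2` only
weakens the bound (the `1/m` of the crux is not used). -/
theorem crux_of_avgBound (hX : MergeFreeAverageBound) (hY : YaoOnMergeFree) :
    ∃ c : ℝ, 0 < c ∧ ∀ m T : ℕ, 2 ≤ m → 1 ≤ T → T + 1 ≤ 2 ^ (m - 1) →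
      c * min ((T : ℝ) + 1) (Real.sqrt (2 ^ m)) / m ≤ (svlQ m T : ℝ) := by
  obtain ⟨C, hC, hX⟩ := hX
  refine ⟨min (1 / 2) (1 / (12 * C)), by positivity, fun m T hm hT hTm => ?_⟩
  set c : ℝ := min (1 / 2) (1 / (12 * C)) with hc
  have hc2 : c ≤ 1 / 2 := min_le_left _ _
  have hc12 : c ≤ 1 / (12 * C) := min_le_right _ _
  have hcpos : 0 < c := by positivity
  have hmR : (2 : ℝ) ≤ m := by exact_mod_cast hm
  have hm1 : (1 : ℝ) ≤ m := by linarith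
  have hN : 0 < Real.sqrt (2 ^ m) := Real.sqrt_pos.2 (by positivity)
  have hmin0 : 0 ≤ min ((T : ℝ) + 1) (Real.sqrt (2 ^ m)) := le_min (by positivity) hN.le
  -- the optimal algorithm
  obtain ⟨A, hAq, hA⟩ := exists_queries_eq_quantumQueryComplexityOn
    (N := 2 ^ m * m + 2 ^ m * (T + 1)) (by norm_num : (0 : ℝ) ≤ 1 / 3) (svlPromise m T) (svlSinkBit m T)
  have hqQ : (A.queries : ℝ) = (svlQ m T : ℝ) := congrArg (fun n : ℕ => (n : ℝ)) hAq
  have hQ1 : (1 : ℝ) ≤ (svlQ m T : ℝ) := by exact_mod_cast one_le_svlQ_of_hyps hT hTm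
  have hq1 : (1 : ℝ) ≤ A.queries := by rw [hqQ]; exact hQ1
  -- dividing by `m ≥ 1` only helps
  have hdiv : c * min ((T : ℝ) + 1) (Real.sqrt (2 ^ m)) / m ≤
      c * min ((T : ℝ) + 1) (Real.sqrt (2 ^ m)) := by
    rw [div_le_iff₀ (by linarith)]
    have h0 : 0 ≤ c * min ((T : ℝ) + 1) (Real.sqrt (2 ^ m)) := by positivity
    nlinarith
  refine hdiv.trans ?_
  by_cases hqT : A.queries + 1 ≤ T
  · -- Grover branch
    have h1 : (2 : ℝ) / 3 ≤ 1 / 2 + C * ((A.queries : ℝ) + 1) / Real.sqrt (2 ^ m) :=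
      (hY m T A hT hTm hA).trans (hX m T A hT hTm hqT)
    have h16 : (1 : ℝ) / 6 ≤ C * ((A.queries : ℝ) + 1) / Real.sqrt (2 ^ m) := by linarith
    have h2 : 1 / 6 * Real.sqrt (2 ^ m) ≤ C * ((A.queries : ℝ) + 1) := (le_div_iff₀ hN).1 h16
    have h25 : C * ((A.queries : ℝ) + 1) ≤ C * (2 * (A.queries : ℝ)) :=
      mul_le_mul_of_nonneg_left (by linarith) hC.le
    have h3 : Real.sqrt (2 ^ m) ≤ 12 * C * (A.queries : ℝ) := by linarith
    have h4 : 1 / (12 * C) * Real.sqrt (2 ^ m) ≤ (A.queries : ℝ) := by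
      rw [div_mul_eq_mul_div, one_mul, div_le_iff₀ (by positivity)]
      linarith
    calc c * min ((T : ℝ) + 1) (Real.sqrt (2 ^ m))
        ≤ 1 / (12 * C) * Real.sqrt (2 ^ m) :=
          mul_le_mul hc12 (min_le_right _ _) hmin0 (by positivity)
      _ ≤ (A.queries : ℝ) := h4
      _ = (svlQ m T : ℝ) := hqQ
  · -- walk branch
    have hTq : (T : ℝ) ≤ A.queries := by exact_mod_cast (show T ≤ A.queries by omega)
    have hT1 : (1 : ℝ) ≤ T := by exact_mod_cast hT
    calc c * min ((T : ℝ) + 1) (Real.sqrt (2 ^ m))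
        ≤ 1 / 2 * ((T : ℝ) + 1) := mul_le_mul hc2 (min_le_left _ _) hmin0 (by norm_num)
      _ ≤ (T : ℝ) := by linarith
      _ ≤ (A.queries : ℝ) := hTq
      _ = (svlQ m T : ℝ) := hqQ

/-- **The composition with the four stub STATEMENTS as hypotheses** (sorry-free): classical inputs
P1, K2a, K2b ⇒ (engine K1) X⁺; X⁺ + Yao (K3, proved: `yaoOnMergeFree_holds`) ⇒ crux. -/
theorem crux_of_parts (hP1 : ChainBound) (hK2a : PosteriorDichotomy) (hK2b : ParityBalance)
    (hK1 : ChainBound → PosteriorDichotomy → ParityBalance → MergeFreeAverageBound) :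
    ∃ c : ℝ, 0 < c ∧ ∀ m T : ℕ, 2 ≤ m → 1 ≤ T → T + 1 ≤ 2 ^ (m - 1) →
      c * min ((T : ℝ) + 1) (Real.sqrt (2 ^ m)) / m ≤ (svlQ m T : ℝ) :=
  crux_of_avgBound (hK1 hP1 hK2a hK2b) yaoOnMergeFree_holds

/-- **THE COMPOSITION.** The crux `WhiteBoxWalk.WbwVerifiableLineNoSpeedup` BY NAME (`Negative.crux_iff` is
`Iff.rfl`) from the four registered stubs (`sorry` lives only inside `stub_*`); the only theorem of this file
whose stated conclusion is the crux decl, and it takes no hypotheses. -/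
theorem WbwVerifiableLineNoSpeedup_of : WbwVerifiableLineNoSpeedup :=
  crux_iff.2 <| crux_of_parts stub_chainBound stub_posteriorDichotomy stub_parityBalance
    (fun h1 h2 h3 => stub_recordingEngine h1 h2 h3)

end Summit.QuantumAdvantage.QuantumAdvantage.Cruxes.WbwVerifiableLineNoSpeedup.MergefreeLineRecording

end
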